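import Mathlib.Analysis.Complex.UpperHalfPlane.Manifold
import Literature.IUT.HodgeTheaters.LocalFrobenioidsArch
import Literature.AnabelianGeometry.AbsoluteAnabelian.AutHolomorphicSpaces
import HarnessLib

/-!
# [IUTchI] Ex 3.4 (i) — NON-VACUITY of the stub `S3Local.AutHolOrbispace` (row «NV-L5/S3Local.AutHolOrbispace»)

Mochizuki, *Inter-universal Teichmüller theory I*, kurims manuscript (May 2020), Example 3.4 (i) p. 80:
"`X_v, C_v, X̲_v, C̲_v, X̲→_v, C̲→_v` … for the Aut-holomorphic orbispaces [cf. [AbsTopIII] Remark 2.1.1]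
determined, respectively, by the hyperbolic orbicurves `X_K, …` at `v`"; [AbsTopIII] Definition 2.1 (i) p. 50:
"the group `𝒜_X(U) := Aut^hol(U)` of holomorphic automorphisms of `U` … regarded as a subgroup of
`Aut(U^top)`; the pair `𝕏 = (X^top, 𝒜_X)` the Aut-holomorphic space".

abc-iut-L5-t2's stub `S3Local.AutHolOrbispace` (`LocalFrobenioidsArch.lean`: a carrier topological space and a
subgroup `autHol ≤ Aut(carrier^top)`, "only the shape is recorded", TODO-merge:abc-iut-L4-t2) is inhabited in
the tree only DEGENERATELY (`Dv := {carrier := PUnit, autHol := ⊥}` of `LocalFrobenioidsArchModel.lean`;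
abc-iut-w5-d197's INHABITATION CENSUS L5 v1 §A′).  WITNESS-class companion (one constructor `def`, content
check only, no freeze owed) recording GENUINE inhabitants, built BY NAME from abc-iut-L4-t2's printed notion
`Literature.AnabelianGeometry.AbsoluteAnabelian.holAut` ([AbsTopIII] Def 2.1 (i)):

* `S3Local.AutHolOrbispace.ofCharted X` — for ANY space `X` charted over `ℂ` (a Riemann surface when it is a
  complex manifold), the pair `(X^top, Aut^hol(X))`: L4's `holAut (⊤ : Opens X)` transported along the
  tautological homeomorphism `↥(⊤ : Opens X) ≃ₜ X` (`homeoConj`, L4);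
* `mem_autHol_ofCharted_iff` — read-back: `φ ∈ (ofCharted X).autHol` iff `φ` and `φ⁻¹` are holomorphic
  (Mathlib `MDifferentiable 𝓘(ℂ, ℂ) 𝓘(ℂ, ℂ)`), i.e. the stub's `autHol` IS print's `Aut^hol(X^top)`;
* `nonempty_model` — `Nonempty S3Local.AutHolOrbispace.{0}` by the complex plane;
* `upperHalfPlane_smul_mem_autHol` — at Mathlib's upper half-plane `ℍ` (the universal covering of the
  hyperbolic Riemann surfaces `X̲→_v(ℂ)` of Ex 3.4), every Möbius transformation `τ ↦ g • τ`, `g ∈ GL₂(ℝ)⁺`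
  (in particular `g ∈ SL₂(ℝ)`), lies in `(ofCharted ℍ).autHol` — a non-identity, GENUINE family
  (that `PSL₂(ℝ)` is ALL of `Aut^hol(ℍ)` is classical and NOT claimed here);
* `examples` at the open unit disc `unitDiscOpens` of L4 (an "Aut-holomorphic disc").

HONEST LABEL: `_model` = the printed object of [AbsTopIII] Def 2.1 (i) at the level of the L5 stub (which
records `𝒜_X(X)` only, not the whole assignment `U ↦ 𝒜_X(U)` — that is L4's `AutHolStructure.ofCharted`).
Nothing of [IUTchI] is asserted; a witness is consistency evidence only; no side is taken on [IUTchIII]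
Cor 3.12. [claim: Mochizuki2012, status: disputed]
-/

namespace Literature.IUT.HodgeTheaters

namespace S3Local.AutHolOrbispace

open _root_.TopologicalSpace _root_.Topology
open scoped _root_.Manifold
open Literature.AnabelianGeometry.AbsoluteAnabelian (holAut homeoConj mem_holAut_iff)

universe u

section OfCharted

variable (X : Type u) [TopologicalSpace X]

/-- The tautological homeomorphism `↥(⊤ : Opens X) ≃ₜ X` (the whole space as an open subset).
([IUTchI] Ex 3.4 (i) p.80) [folklore] -/
def topHomeo : (⊤ : Opens X) ≃ₜ X where
  toFun x := x.1
  invFun x := ⟨x, Opens.mem_top x⟩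
  left_inv _ := rfl
  right_inv _ := rfl
  continuous_toFun := continuous_subtype_val
  continuous_invFun := continuous_id.subtype_mk _

variable [ChartedSpace ℂ X]

/-- **MODEL constructor** ([IUTchI] Ex 3.4 (i) p. 80 / [AbsTopIII] Def 2.1 (i) p. 50): the Aut-holomorphic
space `𝕏 = (X^top, Aut^hol(X))` of a space `X` charted over `ℂ`, as an inhabitant of abc-iut-L5-t2's stub —
`autHol :=` abc-iut-L4-t2's `holAut (⊤ : Opens X)` transported along `topHomeo X`.
[cite: MochizukiAbsTopIII2015, Definition 2.1 (i) p.50] [claim: Mochizuki2012, status: disputed] -/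
abbrev ofCharted : S3Local.AutHolOrbispace.{u} where
  carrier := X
  autHol := (holAut (⊤ : Opens X)).map (homeoConj (topHomeo X)).toMonoidHom

/-- The carrier of the model is `X^top`. [claim: Mochizuki2012, status: disputed] -/
@[simp] theorem ofCharted_carrier : (ofCharted X).carrier = X := rfl

/-- The Aut-holomorphic structure of the model, by definition (L4's `holAut ⊤`, transported).
[claim: Mochizuki2012, status: disputed] -/
theorem ofCharted_autHol :
    (ofCharted X).autHol = (holAut (⊤ : Opens X)).map (homeoConj (topHomeo X)).toMonoidHom := rfl

variable {X}

/-- Holomorphy on the whole space read through the open subset `⊤`: a self-map `g` of `X` is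
`MDifferentiable` iff its tautological restriction `↥⊤ → ↥⊤` is (Mathlib's local-invariant-property
transfer lemmas for `Subtype.val`). [folklore] -/
private theorem mdifferentiable_top_iff (g : X → X) :
    MDifferentiable 𝓘(ℂ, ℂ) 𝓘(ℂ, ℂ)
        (fun x : (⊤ : Opens X) => (⟨g x.1, Opens.mem_top _⟩ : (⊤ : Opens X))) ↔
      MDifferentiable 𝓘(ℂ, ℂ) 𝓘(ℂ, ℂ) g := by
  have key : ∀ x : (⊤ : Opens X),
      MDifferentiableAt 𝓘(ℂ, ℂ) 𝓘(ℂ, ℂ)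
          (fun x : (⊤ : Opens X) => (⟨g x.1, Opens.mem_top _⟩ : (⊤ : Opens X))) x ↔
        MDifferentiableAt 𝓘(ℂ, ℂ) 𝓘(ℂ, ℂ) g x.1 := by
    intro x
    have h1 := (ChartedSpace.liftPropWithinAt_subtypeVal_comp_iff
      (P := DifferentiableWithinAtProp 𝓘(ℂ, ℂ) 𝓘(ℂ, ℂ)) (U := (⊤ : Opens X))
      (fun x : (⊤ : Opens X) => (⟨g x.1, Opens.mem_top _⟩ : (⊤ : Opens X))) Set.univ x)
    have h2 := (differentiableWithinAt_localInvariantProp (I := 𝓘(ℂ, ℂ))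
      (I' := 𝓘(ℂ, ℂ))).liftPropAt_iff_comp_subtype_val (U := (⊤ : Opens X)) g x
    rw [MDifferentiableAt, MDifferentiableAt, ChartedSpace.LiftPropAt, ChartedSpace.LiftPropAt, ← h1]
    exact h2.symm
  exact ⟨fun h x => (key ⟨x, Opens.mem_top x⟩).1 (h _), fun h x => (key x).2 (h x.1)⟩

/-- **READ-BACK** ([AbsTopIII] Def 2.1 (i) p. 50 "`Aut^hol(U)` … holomorphic automorphisms"): a self-homeomorphism
of `X` lies in `(ofCharted X).autHol` iff it and its inverse are holomorphic.
[cite: MochizukiAbsTopIII2015, Definition 2.1 (i) p.50] [claim: Mochizuki2012, status: disputed] -/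
theorem mem_autHol_ofCharted_iff (φ : X ≃ₜ X) :
    φ ∈ (ofCharted X).autHol ↔
      MDifferentiable 𝓘(ℂ, ℂ) 𝓘(ℂ, ℂ) (⇑φ) ∧ MDifferentiable 𝓘(ℂ, ℂ) 𝓘(ℂ, ℂ) (⇑φ.symm) := by
  rw [ofCharted_autHol, Subgroup.mem_map_equiv, mem_holAut_iff]
  exact Iff.and (mdifferentiable_top_iff (⇑φ)) (mdifferentiable_top_iff (⇑φ.symm))

variable (X) in
/-- The identity is a holomorphic automorphism: `1 ∈ (ofCharted X).autHol`.
[cite: MochizukiAbsTopIII2015, Definition 2.1 (i) p.50] [claim: Mochizuki2012, status: disputed] -/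
theorem refl_mem_autHol_ofCharted : Homeomorph.refl X ∈ (ofCharted X).autHol :=
  (mem_autHol_ofCharted_iff _).2 ⟨mdifferentiable_id, mdifferentiable_id⟩

/-- `(ofCharted X).autHol` is closed under composition and inversion with the read-back criterion
(a subgroup, as print requires "regarded as a subgroup of `Aut(U^top)`").
[cite: MochizukiAbsTopIII2015, Definition 2.1 (i) p.50] [claim: Mochizuki2012, status: disputed] -/
theorem trans_mem_autHol_ofCharted {φ ψ : X ≃ₜ X} (hφ : φ ∈ (ofCharted X).autHol)
    (hψ : ψ ∈ (ofCharted X).autHol) : φ.trans ψ ∈ (ofCharted X).autHol := by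
  rw [mem_autHol_ofCharted_iff] at hφ hψ ⊢
  exact ⟨hψ.1.comp hφ.1, hφ.2.comp hψ.2⟩

end OfCharted

/-! ### Instances: the complex plane, the open unit disc, the upper half-plane -/

/-- **NON-VACUITY (model)**: the stub `S3Local.AutHolOrbispace` has a GENUINE inhabitant at universe `0` —
the Aut-holomorphic space of the complex plane. ([IUTchI] Ex 3.4 (i) p.80) [claim: Mochizuki2012, status: disputed] -/
theorem nonempty_model : Nonempty S3Local.AutHolOrbispace.{0} := ⟨ofCharted ℂ⟩

/-- The model over `ℂ` has carrier `ℂ` and contains every translation `z ↦ z + a` (holomorphic with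
holomorphic inverse) — a non-identity element for `a ≠ 0`.
([IUTchI] Ex 3.4 (i) p.80) [claim: Mochizuki2012, status: disputed] -/
theorem addRight_mem_autHol_complex (a : ℂ) :
    (Homeomorph.addRight a : ℂ ≃ₜ ℂ) ∈ (ofCharted ℂ).autHol := by
  rw [mem_autHol_ofCharted_iff]
  refine ⟨?_, ?_⟩
  · exact ((differentiable_id.add_const a).mdifferentiable :
      MDifferentiable 𝓘(ℂ, ℂ) 𝓘(ℂ, ℂ) fun z : ℂ => z + a)
  · exact ((differentiable_id.add_const (-a)).mdifferentiable :
      MDifferentiable 𝓘(ℂ, ℂ) 𝓘(ℂ, ℂ) fun z : ℂ => z + -a)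

open Literature.AnabelianGeometry.AbsoluteAnabelian (unitDiscOpens) in
/-- An "Aut-holomorphic disc" ([AbsTopIII] Def 2.1 (i)): the model over L4's open unit disc inhabits the stub,
with carrier the disc. ([IUTchI] Ex 3.4 (i) p.80) [claim: Mochizuki2012, status: disputed] -/
example : (ofCharted unitDiscOpens).carrier = ↥unitDiscOpens := rfl

open _root_.UpperHalfPlane in
/-- **The upper half-plane** `ℍ` (Mathlib `UpperHalfPlane`, charted over `ℂ` by the open embedding
`ℍ ↪ ℂ`; the universal covering of the hyperbolic Riemann surfaces of Ex 3.4): every Möbius transformation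
`τ ↦ g • τ` with `g ∈ GL₂(ℝ)`, `det g > 0`, is a holomorphic automorphism with holomorphic inverse
`τ ↦ g⁻¹ • τ` (Mathlib `UpperHalfPlane.mdifferentiable_smul`), hence lies in `(ofCharted ℍ).autHol`.
GENUINE, non-identity family. ([IUTchI] Ex 3.4 (i) p.80) [claim: Mochizuki2012, status: disputed] -/
theorem upperHalfPlane_smul_mem_autHol (g : GL (Fin 2) ℝ) (hg : 0 < g.det.val) :
    (Homeomorph.smul g : ℍ ≃ₜ ℍ) ∈ (ofCharted ℍ).autHol := by
  rw [mem_autHol_ofCharted_iff]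
  have hg' : 0 < (g⁻¹).det.val := by
    rw [map_inv, Units.val_inv_eq_inv_val]
    exact inv_pos.2 hg
  refine ⟨?_, ?_⟩
  · exact mdifferentiable_smul hg
  · have : (⇑(Homeomorph.smul g : ℍ ≃ₜ ℍ).symm) = fun τ : ℍ => g⁻¹ • τ := by
      funext τ; rfl
    rw [this]
    exact mdifferentiable_smul hg'

open _root_.UpperHalfPlane in
/-- In particular every element of `SL₂(ℝ)` acts on `ℍ` by an element of `(ofCharted ℍ).autHol`
(`PSL₂(ℝ) ↪ Aut^hol(ℍ)`; equality is classical and not claimed).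
([IUTchI] Ex 3.4 (i) p.80) [claim: Mochizuki2012, status: disputed] -/
theorem upperHalfPlane_smul_mem_autHol_SL (g : Matrix.SpecialLinearGroup (Fin 2) ℝ) :
    (Homeomorph.smul (g : GL (Fin 2) ℝ) : ℍ ≃ₜ ℍ) ∈ (ofCharted ℍ).autHol :=
  upperHalfPlane_smul_mem_autHol _ (by simp)

open _root_.UpperHalfPlane in
/-- The subgroup of `Aut(ℍ^top)` generated by the Möbius transformations of `SL₂(ℝ)` is contained in the
Aut-holomorphic structure of the model. ([IUTchI] Ex 3.4 (i) p.80) [claim: Mochizuki2012, status: disputed] -/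
theorem closure_moebius_le_autHol :
    Subgroup.closure (Set.range fun g : Matrix.SpecialLinearGroup (Fin 2) ℝ =>
        (Homeomorph.smul (g : GL (Fin 2) ℝ) : ℍ ≃ₜ ℍ)) ≤ (ofCharted ℍ).autHol := by
  rw [Subgroup.closure_le]
  rintro _ ⟨g, rfl⟩
  exact upperHalfPlane_smul_mem_autHol_SL g

/-- The model at `ℍ` has carrier the upper half-plane. ([IUTchI] Ex 3.4 (i) p.80) [claim: Mochizuki2012, status: disputed] -/
example : (ofCharted UpperHalfPlane).carrier = UpperHalfPlane := rfl

/-- NON-DEGENERACY at `ℂ`: the Aut-holomorphic structure of the model over the complex plane is not the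
trivial subgroup (the translation `z ↦ z + 1` is a non-identity holomorphic automorphism) — contrast the
tree's degenerate inhabitant `autHol := ⊥` over `PUnit`. ([IUTchI] Ex 3.4 (i) p.80) [claim: Mochizuki2012, status: disputed] -/
theorem autHol_complex_ne_bot : (ofCharted ℂ).autHol ≠ ⊥ := by
  intro h
  have h1 := addRight_mem_autHol_complex 1
  rw [h, Subgroup.mem_bot] at h1
  have h2 := congrArg (fun φ : ℂ ≃ₜ ℂ => φ 0) h1
  simp at h2

end S3Local.AutHolOrbispace

end Literature.IUT.HodgeTheaters
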